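import Summits.ResolutionOfSingularities.ResolutionOfSingularities.Theorems.FrobeniusClosingSteerEventualMonomial
import Mathlib.RingTheory.UniqueFactorizationDomain.Multiplicity
import Mathlib.RingTheory.Noetherian.UniqueFactorizationDomain
import HarnessLib

/-!
# Crux `Steer` (stmt-ResolutionOfSingularities-16345), line `switching_dichotomy`, the NSCᴹ budget line (idea-2 card 3):
# U3 · `FarPthPowerNearReduction` — a radicand `p`-th power × NEAR × power of the hull parameter is reborn, at some member,
# from a TOROIDAL or a UNIT radicand (no blow-up needed)

OURS (campaign `res-hironaka`, rung L ★L-G4, slot W4.1, chain W4.1; seat `res-L0-w41-stub-4` g4; Theses-free, definition-free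
helper for res-L0-w41-plan-1's UNCLAIMED-STUB LIST 08:41:57Z object U3 = res-L0-w41-idea-2's support Prop
`Idea2g4.FarPthPowerNearReduction p` (Sketch-idea-2f 64403cb98dc5de30 l.868), vocabulary `IsPointSequenceAlong` / `shannonExt` /
`IsHullParameter` / `IsNear` / `GenAt` / `ToroidalAt` UNFOLDED; replaces the role of no printed item; NOT a statement of the manuscript
under review [claim: Hironaka2017, status: under-review]; AI-produced, which is weaker than expert review).

**REPAIR.** As typed the Prop is refutable (t := x⁻¹, m := 1, u := 1, j := −p: no member carries a generator of x⁻¹, which is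
not integral over any member; found independently by res-D-pv-035 08:54:35Z). We add the binder `t ^ p ∈ ⋃ R i` (weakest form;
`farPthPowerNearReduction`) and give the repair of record `t ^ p ∈ R 0` (res-L0-w41-plan-1 RULING 24a; the consumer's `CoreDatum` has
`t ^ p ∈ A₀ ⊆ R 0`) as the corollary `farPthPowerNearReduction_of_mem_zero`. Binders not used
by the proof (`A₀.FG`, the second clause of `IsHullParameter`, `∀ i, R i ≤ O`, `u ≠ 0`) are dropped; the `_holds` leaf over the
hoisted vocabulary discards them.

**Statement (`farPthPowerNearReduction`).** Along the point sequence `R` of `A₀ ⊆ O` (regular at the centre), with `x` a regular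
parameter of some member, `m ∈ S = ⋃ R i`, `u ∈ S` NEAR (`u · s = x ^ n`, `s ∈ S`), `t ^ p ∈ R 0` and `t ^ p = m ^ p · u · x ^ j`
(`j ∈ ℤ`): some member `R i` carries `s'` with `s' ^ p ∈ R i`, `t ∈ R i[s']`, and `s' ^ p` either a monomial in a part of a regular
system of parameters of `R i` times a unit WITH AN EXPONENT PRIME TO `p`, or a UNIT of `R i`.

**Proof.** Members are regular local, dominated by `O`, increasing (tree: `isRegularLocalRing_sequence`, `sequence_dominates`,
`sequence_monotone`); `x` is a monomial × unit in a part `z` of a regular system of parameters of EVERY later member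
(`exists_monomial_along` over the landed `stub_rsopMonomialStep`, HLOST Lemma 2.7); at a member containing `m, u, s`: `u · s = x ^ n` makes
`u` a monomial × unit in the SAME `z` (`exists_monomial_of_mul_eq`); so `t ^ p · z ^ B · U₁ = m ^ p · z ^ A · U₂` in that member
(`B = 0` if `j ≥ 0`, `B = |j|·e` else). PURE ALGEBRA (`exists_pow_mul_monomial`): pull the `z`-part out of `m` (`m = m₁ z ^ μ`,
`z_l ∤ m₁` — `WfDvdMonoid.max_power_factor'`), compare `z_l`-exponents using primality and pairwise non-divisibility of the `z_l`
(`IsRsopPart.prime`, `IsRsopPart.not_dvd`) to get `B ≤ A + pμ` and `t ^ p = m₁ ^ p · U · z ^ C`, `C ≥ 0`; Euclid `C = p q + r`;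
`s' := t / (m₁ z ^ q)`. [cite: HeinzerEtAl2015, Prop. 4.4, Lemma 2.7] [folklore]
-/

-- `Summit.<S>.<S>.…` duplicates the summit name by design (single-problem summit).
set_option linter.dupNamespace false

open IsLocalRing
open Literature.AlgebraicGeometry.Resolution

namespace Summit.ResolutionOfSingularities.ResolutionOfSingularities.Theorems.SwitchingDichotomy

namespace FarPthPowerNear

/-! ## Pure algebra: `p`-stripping a monomial equation in a domain -/

section Algebra

variable {S : Type*} [CommRing S] [IsDomain S]

omit [IsDomain S] in
/-- **Pulling the `z`-part out of `m`.** In a domain with ACC on principal ideals (`WfDvdMonoid`), for non-units `z_l` and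
`m ≠ 0`: `m = m₁ · ∏ z_l ^ μ_l` with `z_l ∤ m₁` for every `l`. [folklore] -/
theorem exists_eq_mul_prod_pow_not_dvd [WfDvdMonoid S] {s : ℕ} (z : Fin s → S) (hz : ∀ l, ¬ IsUnit (z l))
    {m : S} (hm : m ≠ 0) :
    ∃ (m₁ : S) (μ : Fin s → ℕ), m = m₁ * ∏ l, z l ^ μ l ∧ ∀ l, ¬ z l ∣ m₁ := by
  classical
  suffices H : ∀ I : Finset (Fin s), ∃ (m₁ : S) (μ : Fin s → ℕ),
      m = m₁ * ∏ l ∈ I, z l ^ μ l ∧ ∀ l ∈ I, ¬ z l ∣ m₁ by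
    obtain ⟨m₁, μ, h1, h2⟩ := H Finset.univ
    exact ⟨m₁, μ, h1, fun l => h2 l (Finset.mem_univ l)⟩
  intro I
  induction I using Finset.induction_on with
  | empty => exact ⟨m, fun _ => 0, by simp, fun l hl => absurd hl (by simp)⟩
  | insert l₀ I hl₀ ih =>
    obtain ⟨m₁, μ, hm₁, hnd⟩ := ih
    have hm₁0 : m₁ ≠ 0 := by
      rintro rfl
      exact hm (by rw [hm₁, zero_mul])
    obtain ⟨n, a, hna, hm₁a⟩ := WfDvdMonoid.max_power_factor' hm₁0 (hz l₀)
    refine ⟨a, Function.update μ l₀ n, ?_, ?_⟩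
    · rw [Finset.prod_insert hl₀, Function.update_self, hm₁, hm₁a]
      have : ∏ l ∈ I, z l ^ Function.update μ l₀ n l = ∏ l ∈ I, z l ^ μ l :=
        Finset.prod_congr rfl fun l hl => by
          rw [Function.update_of_ne (ne_of_mem_of_not_mem hl hl₀)]
      rw [this]
      ring
    · intro l hl
      rcases Finset.mem_insert.mp hl with rfl | hl
      · exact hna
      · intro hdvd
        exact hnd l hl (hm₁a ▸ dvd_mul_of_dvd_right hdvd _)

/-- **Exponent comparison.** For primes `z_l`, pairwise non-dividing, `c` divisible by no `z_l`, and
`T · ∏ z ^ B = c · ∏ z ^ A`: `B ≤ A` coordinatewise and `T = c · ∏ z ^ (A − B)`. [folklore] -/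
theorem le_and_eq_of_mul_prod_pow_eq {s : ℕ} {z : Fin s → S} (hp : ∀ l, Prime (z l))
    (hnd : ∀ l l', l ≠ l' → ¬ z l ∣ z l') {c T : S} (hc : ∀ l, ¬ z l ∣ c) (A B : Fin s → ℕ)
    (h : T * ∏ l, z l ^ B l = c * ∏ l, z l ^ A l) :
    (∀ l, B l ≤ A l) ∧ T = c * ∏ l, z l ^ (A l - B l) := by
  classical
  have hBA : ∀ l, B l ≤ A l := by
    intro l
    by_contra hlt
    push Not at hlt
    have hndvd : ¬ z l ∣ c * ∏ l' ∈ Finset.univ.erase l, z l' ^ A l' := by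
      intro hd
      rcases (hp l).dvd_or_dvd hd with hd | hd
      · exact hc l hd
      · obtain ⟨l', hl', hd'⟩ := (hp l).exists_mem_finset_dvd hd
        exact hnd l l' (Finset.ne_of_mem_erase hl').symm ((hp l).dvd_of_dvd_pow hd')
    have h1 : z l ^ (A l + 1) ∣ T * ∏ l', z l' ^ B l' :=
      (pow_dvd_pow (z l) hlt).trans
        ((Finset.dvd_prod_of_mem (fun l' => z l' ^ B l') (Finset.mem_univ l)).trans (dvd_mul_left _ _))
    rw [h, ← Finset.mul_prod_erase _ _ (Finset.mem_univ l), pow_succ] at h1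
    have h2 : z l ^ A l * z l ∣ z l ^ A l * (c * ∏ l' ∈ Finset.univ.erase l, z l' ^ A l') := by
      convert h1 using 1
      ring
    exact hndvd ((mul_dvd_mul_iff_left (pow_ne_zero _ (hp l).ne_zero)).mp h2)
  refine ⟨hBA, ?_⟩
  have hsplit : ∏ l, z l ^ A l = (∏ l, z l ^ (A l - B l)) * ∏ l, z l ^ B l := by
    rw [← Finset.prod_mul_distrib]
    exact Finset.prod_congr rfl fun l _ => by rw [← pow_add, Nat.sub_add_cancel (hBA l)]
  have hne : ∏ l, z l ^ B l ≠ 0 :=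
    Finset.prod_ne_zero_iff.mpr fun l _ => pow_ne_zero _ (hp l).ne_zero
  apply mul_right_cancel₀ hne
  rw [h, hsplit, mul_assoc]

/-- **`p`-stripping a monomial equation.** Primes `z_l` pairwise non-dividing, `0 < p`, `m ≠ 0`, units `U₁ U₂`, and
`T · ∏ z ^ B · U₁ = m ^ p · ∏ z ^ A · U₂` ⟹ `T = D ^ p · (∏ z ^ r · V)` with `D ≠ 0`, every `r_l < p`, `V` a unit. [folklore] -/
theorem exists_pow_mul_monomial [WfDvdMonoid S] {s : ℕ} {z : Fin s → S} (hp : ∀ l, Prime (z l))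
    (hnd : ∀ l l', l ≠ l' → ¬ z l ∣ z l') {p : ℕ} (hp0 : 0 < p) {T m : S} (hm : m ≠ 0)
    {U₁ U₂ : S} (hU₁ : IsUnit U₁) (hU₂ : IsUnit U₂) (A B : Fin s → ℕ)
    (h : T * (∏ l, z l ^ B l) * U₁ = m ^ p * (∏ l, z l ^ A l) * U₂) :
    ∃ (D : S) (r : Fin s → ℕ) (V : S), D ≠ 0 ∧ (∀ l, r l < p) ∧ IsUnit V ∧
      T = D ^ p * ((∏ l, z l ^ r l) * V) := by
  classical
  obtain ⟨m₁, μ, hmμ, hm₁⟩ := exists_eq_mul_prod_pow_not_dvd z (fun l => (hp l).not_unit) hm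
  have hm₁0 : m₁ ≠ 0 := by
    rintro rfl
    exact hm (by rw [hmμ, zero_mul])
  obtain ⟨u₁, rfl⟩ := hU₁
  -- move `U₁` to the right: `c := m₁ ^ p * U₂ * u₁⁻¹`
  have hc : ∀ l, ¬ z l ∣ m₁ ^ p * U₂ * ↑u₁⁻¹ := by
    intro l hd
    rcases (hp l).dvd_or_dvd hd with hd | hd
    · rcases (hp l).dvd_or_dvd hd with hd | hd
      · exact hm₁ l ((hp l).dvd_of_dvd_pow hd)
      · exact (hp l).not_unit (isUnit_of_dvd_unit hd hU₂)
    · exact (hp l).not_unit (isUnit_of_dvd_unit hd (Units.isUnit _))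
  have h' : T * ∏ l, z l ^ B l = (m₁ ^ p * U₂ * ↑u₁⁻¹) * ∏ l, z l ^ (A l + p * μ l) := by
    have e1 : T * ∏ l, z l ^ B l = (m ^ p * (∏ l, z l ^ A l) * U₂) * ↑u₁⁻¹ := by
      rw [← h, Units.mul_inv_cancel_right]
    have e2 : ∏ l, z l ^ (A l + p * μ l) = (∏ l, z l ^ A l) * (∏ l, z l ^ μ l) ^ p := by
      rw [← Finset.prod_pow, ← Finset.prod_mul_distrib]
      exact Finset.prod_congr rfl fun l _ => by rw [pow_add, pow_mul']
    rw [e1, hmμ, e2, mul_pow]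
    ring
  obtain ⟨-, hT⟩ := le_and_eq_of_mul_prod_pow_eq hp hnd hc _ B h'
  refine ⟨m₁ * ∏ l, z l ^ ((A l + p * μ l - B l) / p), fun l => (A l + p * μ l - B l) % p,
    U₂ * ↑u₁⁻¹, ?_, fun l => Nat.mod_lt _ hp0, hU₂.mul (Units.isUnit _), ?_⟩
  · exact mul_ne_zero hm₁0 (Finset.prod_ne_zero_iff.mpr fun l _ => pow_ne_zero _ (hp l).ne_zero)
  · have key : ∏ l, z l ^ (A l + p * μ l - B l) =
        (∏ l, z l ^ ((A l + p * μ l - B l) / p)) ^ p * ∏ l, z l ^ ((A l + p * μ l - B l) % p) := by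
      rw [← Finset.prod_pow, ← Finset.prod_mul_distrib]
      exact Finset.prod_congr rfl fun l _ => by rw [← pow_mul, ← pow_add, Nat.div_add_mod']
    rw [hT, key, mul_pow]
    ring

end Algebra

/-! ## U3 · the reduction at one member, then along the point sequence -/

variable {k K : Type} [Field k] [Field K] [Algebra k K]

/-- **The reduction inside ONE regular local member `S ⊆ K`.** `z` part of a regular system of parameters of `S`, `x = z ^ e · w`
(`w` a unit), `m, u, s_w ∈ S`, `m ≠ 0`, `u · s_w = x ^ n`, `t ^ p ∈ S`, `t ^ p = m ^ p · u · x ^ j` (`j ∈ ℤ`, `0 < p`): there is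
`s'` with `s' ^ p ∈ S`, `t ∈ S[s']`, and `s' ^ p` a monomial in `z` times a unit with an exponent prime to `p`, or a unit.
[cite: HeinzerEtAl2015, Prop. 4.4] [folklore] -/
theorem reduction_at_member (p : ℕ) (hp0 : 0 < p) (S : Subring K) [IsRegularLocalRing S]
    {s : ℕ} {z : Fin s → S} (hz : IsRsopPart z) {e : Fin s → ℕ} {w : S} (hw : IsUnit w)
    {x t m u sw : K} (hxe : x = (∏ l, ((z l : S) : K) ^ e l) * (w : K)) (hx0 : x ≠ 0)
    (hmS : m ∈ S) (hm0 : m ≠ 0) (huS : u ∈ S) (hsS : sw ∈ S) {n : ℕ} (husw : u * sw = x ^ n)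
    (htS : t ^ p ∈ S) {j : ℤ} (h : t ^ p = m ^ p * u * x ^ j) :
    ∃ s' : K, (s' ^ p ∈ S ∧ t ∈ Subring.closure (insert s' (S : Set K))) ∧
      ((∃ (r : Fin s → ℕ), (∃ l, ¬ p ∣ r l) ∧ ∃ V : S, IsUnit V ∧
          s' ^ p = (∏ l, ((z l : S) : K) ^ r l) * (V : K)) ∨
        ∃ V : S, IsUnit V ∧ s' ^ p = (V : K)) := by
  classical
  -- `u` is a monomial × unit in the SAME part `z`
  have husw' : u * sw = (∏ l, ((z l : S) : K) ^ (n * e l)) * ((w ^ n : S) : K) := by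
    rw [husw, hxe, mul_pow, ← Finset.prod_pow, SubmonoidClass.coe_pow]
    refine congrArg (· * _) (Finset.prod_congr rfl fun l _ => ?_)
    rw [← pow_mul, mul_comm]
  obtain ⟨a, W, hW, hua⟩ := exists_monomial_of_mul_eq hz (fun l => n * e l) huS hsS (hw.pow n) husw'
  -- the monomial equation in `S`, by the sign of `j`
  have hmS0 : (⟨m, hmS⟩ : S) ≠ 0 := fun h0 => hm0 (congrArg Subtype.val h0)
  obtain ⟨D, r, V, hD0, hr, hV, hT⟩ : ∃ (D : S) (r : Fin s → ℕ) (V : S), D ≠ 0 ∧ (∀ l, r l < p) ∧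
      IsUnit V ∧ (⟨t ^ p, htS⟩ : S) = D ^ p * ((∏ l, z l ^ r l) * V) := by
    rcases Int.eq_nat_or_neg j with ⟨j', rfl | rfl⟩
    · -- `j = j' ≥ 0`: `t ^ p · z ^ 0 · 1 = m ^ p · z ^ (a + j' e) · (W w ^ j')`
      refine exists_pow_mul_monomial (fun l => hz.prime l) (fun l l' hll' => hz.not_dvd hll') hp0
        hmS0 isUnit_one (hW.mul (hw.pow j')) (fun l => a l + j' * e l) (fun _ => 0) ?_
      apply Subtype.ext
      push_cast
      rw [h, hua, zpow_natCast, hxe]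
      simp only [pow_zero, Finset.prod_const_one, mul_one]
      have e2 : ∏ l, ((z l : S) : K) ^ (a l + j' * e l) =
          (∏ l, ((z l : S) : K) ^ a l) * (∏ l, ((z l : S) : K) ^ e l) ^ j' := by
        rw [← Finset.prod_pow, ← Finset.prod_mul_distrib]
        exact Finset.prod_congr rfl fun l _ => by rw [pow_add, pow_mul']
      rw [e2, mul_pow]
      ring
    · -- `j = -j'`: `t ^ p · z ^ (j' e) · w ^ j' = m ^ p · z ^ a · W`
      refine exists_pow_mul_monomial (fun l => hz.prime l) (fun l l' hll' => hz.not_dvd hll') hp0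
        hmS0 (hw.pow j') hW a (fun l => j' * e l) ?_
      apply Subtype.ext
      push_cast
      have hxj : x ^ j' ≠ 0 := pow_ne_zero _ hx0
      have h2 : t ^ p * x ^ j' = m ^ p * u := by
        rw [h, zpow_neg, zpow_natCast, mul_assoc, inv_mul_cancel₀ hxj, mul_one]
      have e2 : ∏ l, ((z l : S) : K) ^ (j' * e l) = (∏ l, ((z l : S) : K) ^ e l) ^ j' := by
        rw [← Finset.prod_pow]
        exact Finset.prod_congr rfl fun l _ => by rw [pow_mul']
      rw [e2]
      calc t ^ p * (∏ l, ((z l : S) : K) ^ e l) ^ j' * ((w : S) : K) ^ j'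
          = t ^ p * ((∏ l, ((z l : S) : K) ^ e l) * ((w : S) : K)) ^ j' := by rw [mul_pow]; ring
        _ = t ^ p * x ^ j' := by rw [← hxe]
        _ = m ^ p * u := h2
        _ = m ^ p * (∏ l, ((z l : S) : K) ^ a l) * ((W : S) : K) := by rw [hua]; ring
  -- the generator `s' := t / D`
  have hDK : ((D : S) : K) ≠ 0 := fun h0 => hD0 (Subtype.ext h0)
  have hTK : t ^ p = ((D : S) : K) ^ p * ((∏ l, ((z l : S) : K) ^ r l) * ((V : S) : K)) := by
    have := congrArg Subtype.val hT
    push_cast at this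
    exact this
  have hs'p : (t / ((D : S) : K)) ^ p = (∏ l, ((z l : S) : K) ^ r l) * ((V : S) : K) := by
    rw [div_pow, hTK, mul_div_cancel_left₀ _ (pow_ne_zero p hDK)]
  have hs'R : (t / ((D : S) : K)) ^ p ∈ S := by
    rw [hs'p]
    exact mul_mem (prod_mem fun l _ => pow_mem (z l).2 _) V.2
  have htgen : t ∈ Subring.closure (insert (t / ((D : S) : K)) (S : Set K)) := by
    have hmul := Subring.mul_mem (Subring.closure (insert (t / ((D : S) : K)) (S : Set K)))
      (Subring.subset_closure (Set.mem_insert (t / ((D : S) : K)) (S : Set K)))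
      (Subring.subset_closure (Set.mem_insert_of_mem _ D.2))
    rwa [div_mul_cancel₀ t hDK] at hmul
  refine ⟨t / ((D : S) : K), ⟨hs'R, htgen⟩, ?_⟩
  by_cases hall : ∀ l, r l = 0
  · -- unit radicand
    refine Or.inr ⟨V, hV, ?_⟩
    rw [hs'p]
    have : ∏ l, ((z l : S) : K) ^ r l = 1 := Finset.prod_eq_one fun l _ => by rw [hall l, pow_zero]
    rw [this, one_mul]
  · -- toroidal radicand: some `0 < r l < p`
    push Not at hall
    obtain ⟨l, hl⟩ := hall
    exact Or.inl ⟨r, ⟨l, fun hdvd => hl (Nat.eq_zero_of_dvd_of_lt hdvd (hr l))⟩, V, hV, hs'p⟩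

/-- **U3 · `FarPthPowerNearReduction`, repaired (`t ^ p ∈ ⋃ R i` added — the weakest repair; the form of record
`t ^ p ∈ R 0` is the corollary below) and unfolded.** Along the point sequence `R` of `A₀ ⊆ O` (regular at the centre of `O`;
`R 0` the local ring at the centre, each `R (i+1)` a quadratic transform of `R i` along `O`), let `x` be a regular parameter of
some member, `m ∈ ⋃ R i`, `u ∈ ⋃ R i` with `u · s = x ^ n` for some `s ∈ ⋃ R i` (NEAR), `t ^ p ∈ ⋃ R i` and
`t ^ p = m ^ p · u · x ^ j` (`j ∈ ℤ`). Then some member `R i` carries `s'` with `s' ^ p ∈ R i` and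
`t ∈ R i[s']` (a generator, `GenAt`) whose radicand `s' ^ p` is EITHER a monomial in a part of a regular system of parameters of
`R i` times a unit with some exponent prime to `p` (`ToroidalAt`) OR a unit of `R i`. [cite: HeinzerEtAl2015, Prop. 4.4, Lemma 2.7]
[folklore] -/
theorem farPthPowerNearReduction (p : ℕ) (O : ValuationSubring K) (A₀ : Subalgebra k K)
    (h₀ : A₀.toSubring ≤ O.toSubring) (R : ℕ → Subring K) (x t m u : K) (j : ℤ)
    (hreg : IsRegularLocalRing (Localization.AtPrime
      (Ideal.comap (Subring.inclusion h₀) (IsLocalRing.maximalIdeal O))))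
    (hR0 : R 0 = locAtCentre A₀.toSubring O)
    (hstep : ∀ i, IsQuadraticTransformAlong O (R i) (R (i + 1)))
    (hx : ∃ (i : ℕ) (_ : IsLocalRing (R i)) (z : Fin 1 → R i), IsRsopPart z ∧ ((z 0 : R i) : K) = x)
    (hm : m ∈ ⨆ i, R i) (hu : u ∈ ⨆ i, R i) (hnear : ∃ (n : ℕ) (s : K), s ∈ ⨆ i, R i ∧ u * s = x ^ n)
    (ht : t ^ p ∈ ⨆ i, R i) (h : t ^ p = m ^ p * u * x ^ j) :
    ∃ (i : ℕ) (_ : IsLocalRing (R i)) (s' : K),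
      (s' ^ p ∈ R i ∧ t ∈ Subring.closure (insert s' (R i : Set K))) ∧
      ((∃ (s : ℕ) (z : Fin s → R i), IsRsopPart z ∧ ∃ (e : Fin s → ℕ), (∃ l, ¬ p ∣ e l) ∧
          ∃ w : R i, IsUnit w ∧ s' ^ p = (∏ l, ((z l : R i) : K) ^ e l) * (w : K)) ∨
        ∃ w : R i, IsUnit w ∧ s' ^ p = (w : K)) := by
  classical
  -- the members: regular local, dominated by `O`, increasing
  have hreg₀ : IsRegularLocalRing (R 0) := by
    rw [hR0]
    exact (isRegularLocalRing_locAtCentre_iff h₀).mpr hreg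
  haveI hRreg : ∀ i, IsRegularLocalRing (R i) := isRegularLocalRing_sequence hreg₀ hstep
  have hdom₀ : SubringDominates (R 0) O.toSubring := by
    rw [hR0]
    exact subringDominates_locAtCentre h₀
  have hRdom : ∀ i, SubringDominates (R i) O.toSubring := fun i =>
    (sequence_dominates hdom₀ hstep i).1
  have hmono : Monotone R := sequence_monotone hstep
  have hdir : Directed (· ≤ ·) R := hmono.directed_le
  -- `p = 0`: `t` itself, radicand `1`
  rcases Nat.eq_zero_or_pos p with rfl | hp0
  · exact ⟨0, inferInstance, t, ⟨by rw [pow_zero]; exact one_mem _,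
      Subring.subset_closure (Set.mem_insert _ _)⟩, Or.inr ⟨1, isUnit_one, by simp⟩⟩
  -- `t = 0`: the generator `1`
  by_cases ht0 : t = 0
  · refine ⟨0, inferInstance, 1, ⟨by rw [one_pow]; exact one_mem _, ?_⟩, Or.inr ⟨1, isUnit_one, by simp⟩⟩
    rw [ht0]
    exact zero_mem _
  have hm0 : m ≠ 0 := by
    rintro rfl
    apply ht0
    apply (pow_eq_zero_iff hp0.ne').mp
    rw [h, zero_pow hp0.ne', zero_mul, zero_mul]
  -- indices
  obtain ⟨i₂, _, z₂, hz₂, hz₂x⟩ := hx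
  have hx0 : x ≠ 0 := by
    rw [← hz₂x]
    exact fun h0 => hz₂.ne_zero 0 (Subtype.ext h0)
  obtain ⟨im, hmR⟩ := (Subring.mem_iSup_of_directed hdir).mp hm
  obtain ⟨iu, huR⟩ := (Subring.mem_iSup_of_directed hdir).mp hu
  obtain ⟨n, sw, hsw, husw⟩ := hnear
  obtain ⟨is', hsR'⟩ := (Subring.mem_iSup_of_directed hdir).mp hsw
  obtain ⟨it, htR⟩ := (Subring.mem_iSup_of_directed hdir).mp ht
  -- one index above the witness of `s` and of `t ^ p`
  have hsR : sw ∈ R (is' + it) := hmono (Nat.le_add_right _ _) hsR'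
  have htR' : t ^ p ∈ R (is' + it) := hmono (Nat.le_add_left _ _) htR
  set is := is' + it with his
  -- `x` is a monomial × unit at the member `R (i₂ + (im + iu + is))`
  have hbase : ∃ (s : ℕ) (z : Fin s → R i₂), IsRsopPart z ∧ ∃ (e : Fin s → ℕ) (w : R i₂),
      IsUnit w ∧ x = (∏ l, ((z l : R i₂) : K) ^ e l) * (w : K) :=
    ⟨1, z₂, hz₂, fun _ => 1, 1, isUnit_one, by simp [hz₂x]⟩
  obtain ⟨s, z, hz, e, w, hw, hxe⟩ :=
    exists_monomial_along stub_rsopMonomialStep O R hstep hRdom i₂ x hbase (im + iu + is)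
  obtain ⟨s', hs', hrad⟩ := reduction_at_member p hp0 (R (i₂ + (im + iu + is))) hz hw hxe hx0
    (hmono (by omega) hmR) hm0 (hmono (by omega) huR) (hmono (by omega) hsR) husw
    (hmono (by omega) htR') h
  refine ⟨i₂ + (im + iu + is), inferInstance, s', hs', ?_⟩
  rcases hrad with ⟨r, hr, V, hV, hs'p⟩ | hunit
  · exact Or.inl ⟨s, z, hz, r, hr, V, hV, hs'p⟩
  · exact Or.inr hunit

/-- **U3 with the repair of record `t ^ p ∈ R 0`** (res-L0-w41-plan-1 RULING 24a; what every consumer has from `CoreDatum`: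
`t ^ p ∈ A₀ ⊆ R 0`). [cite: HeinzerEtAl2015, Prop. 4.4, Lemma 2.7] [folklore] -/
theorem farPthPowerNearReduction_of_mem_zero (p : ℕ) (O : ValuationSubring K) (A₀ : Subalgebra k K)
    (h₀ : A₀.toSubring ≤ O.toSubring) (R : ℕ → Subring K) (x t m u : K) (j : ℤ)
    (hreg : IsRegularLocalRing (Localization.AtPrime
      (Ideal.comap (Subring.inclusion h₀) (IsLocalRing.maximalIdeal O))))
    (hR0 : R 0 = locAtCentre A₀.toSubring O)
    (hstep : ∀ i, IsQuadraticTransformAlong O (R i) (R (i + 1)))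
    (hx : ∃ (i : ℕ) (_ : IsLocalRing (R i)) (z : Fin 1 → R i), IsRsopPart z ∧ ((z 0 : R i) : K) = x)
    (hm : m ∈ ⨆ i, R i) (hu : u ∈ ⨆ i, R i) (hnear : ∃ (n : ℕ) (s : K), s ∈ ⨆ i, R i ∧ u * s = x ^ n)
    (ht : t ^ p ∈ R 0) (h : t ^ p = m ^ p * u * x ^ j) :
    ∃ (i : ℕ) (_ : IsLocalRing (R i)) (s' : K),
      (s' ^ p ∈ R i ∧ t ∈ Subring.closure (insert s' (R i : Set K))) ∧
      ((∃ (s : ℕ) (z : Fin s → R i), IsRsopPart z ∧ ∃ (e : Fin s → ℕ), (∃ l, ¬ p ∣ e l) ∧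
          ∃ w : R i, IsUnit w ∧ s' ^ p = (∏ l, ((z l : R i) : K) ^ e l) * (w : K)) ∨
        ∃ w : R i, IsUnit w ∧ s' ^ p = (w : K)) :=
  farPthPowerNearReduction p O A₀ h₀ R x t m u j hreg hR0 hstep hx hm hu hnear
    (Subring.mem_iSup_of_directed (sequence_monotone hstep).directed_le |>.mpr ⟨0, ht⟩) h

end FarPthPowerNear

end Summit.ResolutionOfSingularities.ResolutionOfSingularities.Theorems.SwitchingDichotomy
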